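import Literature.NumberTheory.Rogawski1990.PreStabilisationCountSelf
import Literature.NumberTheory.Rogawski1990.SumZeroHyperplaneCharacters
import HarnessLib

/-!
# The pre-stabilisation count with the `χ ≠ 1` terms RE-INDEXED BY THE ENDOSCOPIC CLASSES through (5.4.5)'s pinned sign characters:
# `Σ_{[γ] ⊂ 𝒪_st(γ₀)} Φ([toAdelic γ], f) = (1 + #I)⁻¹ · (Φ^{st,𝐀}(γ₀, f) + Σ_{x ∈ I} Φ^{sgn_{s x} ∘ obs, 𝐀}(γ₀, f))` (Rogawski 1990, §5.4 (5.4.2)–(5.4.5) pp. 72–74)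

Topic `NumberTheory/Rogawski1990`; namespace `Literature.NumberTheory.Rogawski1990`; **THEOREMS ONLY** (no definition, no named fact, no instance, no
notation, no `sorry`).  Cell `pub/hodgecm-mathlib`, ENGINE T1 (crux H413 = `stmt-HodgeConjecture-24833`), row O11-1 (RULING #100b (6), second hand of
F0P3a-p01 (g4)): the composition of ★ `MatchingAdeleG₂.stableOrbitalSum_map_toAdelic_eq_of_equiv` (`PreStabilisationCountSelf`, the package reading with an
ABSTRACT `e : I ≃ {χ ∈ 𝓡 ∣ χ ≠ 1}`) with ★ (KS-2b) `exists_equiv_addChar_ne_one_of_sum_deg_eq_three` (`SumZeroHyperplaneCharacters`, the bijection `e(γ₀)`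
with PINNED values `(e x)(ε) = (−1)^{ε (s x)}`), so that the datum `e` DISAPPEARS from the hypotheses: the obstruction group is the sum-zero hyperplane
`A(γ₀) = K ≤ (ℤ∕2)^ι` (`ι` = the simple factors of the Cartan algebra `L[γ₀]`, degrees `deg` with `Σ deg = 3`), `𝓡 = ⊤` (ALL characters of `K`, so Prop. 3.3.1
reads «`obs p = 0 ↔ p` is rational over some `γ`»), the endoscopic classes over `𝒪(γ₀)` are indexed by `s : I → ι` injective onto the degree-one factors, and
the `χ ≠ 1` weights are the COORDINATE SIGNS `W x [q] = (−1)^{(obs q)_{s x}}` — the shape (4.3.3)'s `κ(obs)` takes under ★ `GlobalKappaFormula` for the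
character `κ_{s x}` «defined by `H`» [Rogawski1990, §5.4 p. 74].  HC_CM is proved only modulo the printed citations until rung 0 closes.

* §1 `𝓡 = ⊤`: `(∀ κ ∈ ⊤, κ a = 1) ↔ a = 0` (Mathlib ★ `AddChar.forall_apply_eq_zero`, characters of a finite abelian group separate points), and the
  element-form Hasse clause in the `obs = 0` currency ⇒ the character currency of ★ `PreStabilisationCountSelf`;
* §2 **`MatchingAdeleG₂.stableOrbitalSum_map_toAdelic_eq_of_sum_deg_eq_three`** — the count with the sign weights and the normalisation `(#I + 1)⁻¹`
  (print's `|𝓡(G_γ₀∕F)|⁻¹` with `|𝓡| = 1 + #{𝒪H ↦ 𝒪}`), and **`…_two_pow`** — the same with `(2^{|ι|−1})⁻¹` (`|𝓡| = |𝔇(T∕F)| = 4 ∕ 2 ∕ 1` for the Cartan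
  types (1) ∕ (2) ∕ (3), ★ `card_top_subgroup_addChar_eq_two_pow`), plus the count `#I + 1 = 2^{|ι|−1}`.

## References
* [Rogawski1990] J. D. Rogawski, *Automorphic Representations of Unitary Groups in Three Variables*, Ann. of Math. Stud. 123 (1990), §3.3 Prop. 3.3.1 ∕
  Cor. 3.3.2 p. 22, §3.5 Prop. 3.5.2 (c) p. 29, §3.6 p. 31, §5.4 (5.4.1)–(5.4.5) pp. 72–74, §14.5 Thm. 14.5.1 (a) p. 238.
* [Kottwitz1986] R. E. Kottwitz, *Stable trace formula: elliptic singular terms*, Math. Ann. 275 (1986), §9.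
-/

set_option autoImplicit false

noncomputable section

open NumberField IsDedekindDomain
open scoped BigOperators MatrixGroups

namespace Literature.NumberTheory.Rogawski1990

open Literature.NumberTheory.Automorphic
open Literature.AlgebraicGeometry.ShimuraVarieties (unitaryGroup)

/-! ## §1 `𝓡 = ⊤`: all characters of the finite obstruction group -/

section TopCharacters

variable {A : Type*} [AddCommGroup A] [Finite A]

/-- With `𝓡 = ⊤ ≤ Hom(A, ℂˣ)` (all characters of the finite abelian group `A`): `(∀ κ ∈ 𝓡, κ(a) = 1) ↔ a = 0` — characters separate points
(Mathlib ★ `AddChar.forall_apply_eq_zero`). [cite: Rogawski1990, §3.3 Cor. 3.3.2 p. 22] -/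
theorem forall_mem_top_addChar_apply_eq_one_iff (a : A) : (∀ κ ∈ (⊤ : Subgroup (AddChar A ℂ)), κ a = 1) ↔ a = 0 := by
  rw [← AddChar.forall_apply_eq_zero]
  simp only [Subgroup.mem_top, forall_true_left]

variable {L : Type} [Field L] [NumberField L] [IsCMField L] {H : Matrix (Fin 3) (Fin 3) L} {γ₀ : (UnitaryGroup.cmDatum L 3 H).Rational}

/-- **Prop. 3.3.1 in the `obs = 0` currency ⇒ the character currency of ★ `PreStabilisationCountSelf` (for `𝓡 = ⊤`)**: if a matching adèle `p` over `γ₀` is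
rational over some `γ` iff its obstruction VANISHES, then it is so iff every character of the obstruction group is `1` at `obs p`.
[cite: Rogawski1990, §3.3 Prop. 3.3.1 p. 22; §5.4 p. 72] -/
theorem MatchingAdeleG₂.forall_mem_top_addChar_obs_eq_one_iff (obs : MatchingAdeleG₂ L H H γ₀ → A)
    (hHasse : ∀ p : MatchingAdeleG₂ L H H γ₀, obs p = 0 ↔ ∃ γ, p.IsRationalOver γ) (p : MatchingAdeleG₂ L H H γ₀) :
    (∀ κ ∈ (⊤ : Subgroup (AddChar A ℂ)), κ (obs p) = 1) ↔ ∃ γ, p.IsRationalOver γ := by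
  rw [forall_mem_top_addChar_apply_eq_one_iff, hHasse]

end TopCharacters

/-! ## §2 The count with the `χ ≠ 1` terms indexed by the endoscopic classes and weighted by the coordinate signs -/

section Signs

variable {L : Type} [Field L] [NumberField L] [IsCMField L] {H : Matrix (Fin 3) (Fin 3) L} {γ₀ : (UnitaryGroup.cmDatum L 3 H).Rational}
variable [∀ g : (UnitaryGroup.cmDatum L 3 H).Adelic,
  MeasurableSpace ((UnitaryGroup.cmDatum L 3 H).Adelic ⧸ Subgroup.centralizer ({g} : Set (UnitaryGroup.cmDatum L 3 H).Adelic))]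
variable {ι : Type*} [Fintype ι] [DecidableEq ι] (K : AddSubgroup (ι → ZMod 2)) (hK : ∀ ε, ε ∈ K ↔ ∑ i, ε i = 0)
variable (deg : ι → ℕ) (hdeg : ∀ i, 1 ≤ deg i) (hsum : ∑ i, deg i = 3)
variable {I : Type*} [Fintype I] (s : I → ι) (hs : Function.Injective s) (hrange : ∀ i, (∃ x, s x = i) ↔ deg i = 1)
variable (obs : MatchingAdeleG₂ L H H γ₀ → K)

include hK hdeg hsum hs hrange in
/-- **THE PRE-STABILISATION COUNT WITH THE `χ ≠ 1` TERMS RE-INDEXED BY THE ENDOSCOPIC CLASSES.**  Data: the sum-zero hyperplane `K ≤ (ℤ∕2)^ι` (`hK`) over the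
index `ι` of simple factors of the Cartan algebra of `γ₀` with degrees `deg ≥ 1`, `Σ deg = 3`; the endoscopic classes over `𝒪(γ₀)` indexed by `s : I → ι`,
injective onto the degree-one factors; the obstruction `obs : 𝒞′ → K` on the matching adèles of the self carrier.  Hypotheses (print's words): Prop. 3.3.1
in element form `hHasse` («`obs p = 0 ↔ p` rational»), `k(γ₀) = 1` as `hinj`, and `χ ≠ 1` class weights READING THE COORDINATE SIGNS
`W x [q] = (−1)^{(obs q)_{s x}}` (`hW`).  Conclusion, for every class-indexed orbital family `m` on `U(H)(𝐀)` and every `f` with `Φ_m(·, f)` finitely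
supported on `𝒞′_𝐀(γ₀)`: `Σ_{[γ] ⊂ 𝒪_st(γ₀)} Φ_m([toAdelic γ], f) = (#I + 1)⁻¹ · (Φ^{st,𝐀}(γ₀, f) + Σ_{x ∈ I} adelicKappaOrbitalSum 𝒞′_𝐀(γ₀) (W x) m f)` —
(5.4.2) with (5.4.5)'s bijection `e(γ₀)` (★ `exists_equiv_addChar_ne_one_of_sum_deg_eq_three`) ELIMINATED and `|𝓡(G_γ₀∕F)| = 1 + #{𝒪H ↦ 𝒪}`.
[cite: Rogawski1990, §5.4 (5.4.2)–(5.4.5) pp. 72–74; §3.5 Prop. 3.5.2 (c) p. 29] [cite: Kottwitz1986, §9] -/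
theorem MatchingAdeleG₂.stableOrbitalSum_map_toAdelic_eq_of_sum_deg_eq_three
    (hHasse : ∀ p : MatchingAdeleG₂ L H H γ₀, obs p = 0 ↔ ∃ γ, p.IsRationalOver γ)
    (hinj : Set.InjOn (ConjClasses.map (UnitaryGroup.cmDatum L 3 H).toAdelic) (conjClassesIn (cmConjRingHom L) H γ₀))
    (W : I → ConjClasses (UnitaryGroup.cmDatum L 3 H).Adelic → ℂ)
    (hW : ∀ (x : I) (q : MatchingAdeleG₂ L H H γ₀), W x (ConjClasses.mk q.adele) = (-1 : ℂ) ^ (((obs q : K) : ι → ZMod 2) (s x)).val)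
    (m : OrbitalMeasureFamily (UnitaryGroup.cmDatum L 3 H).Adelic) (f : (UnitaryGroup.cmDatum L 3 H).Adelic → ℂ)
    (hfin : (MatchingAdeleG₂.classes L H H γ₀ ∩ Function.support fun δ => classOrbitalIntegral m f δ).Finite) :
    stableOrbitalSum (cmConjRingHom L) H (fun c => classOrbitalIntegral m f (ConjClasses.map (UnitaryGroup.cmDatum L 3 H).toAdelic c)) γ₀ =
      ((Fintype.card I : ℂ) + 1)⁻¹ * (adelicStableOrbitalSum (MatchingAdeleG₂.classes L H H γ₀) m f +
        ∑ x, adelicKappaOrbitalSum (MatchingAdeleG₂.classes L H H γ₀) (W x) m f) := by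
  classical
  haveI : Fintype (⊤ : Subgroup (AddChar K ℂ)) := Fintype.ofFinite _
  obtain ⟨e, he⟩ := exists_equiv_addChar_ne_one_of_sum_deg_eq_three K hK deg hdeg hsum s hs hrange
  have hW' : ∀ (x : I) (q : MatchingAdeleG₂ L H H γ₀),
      W x (ConjClasses.mk q.adele) = (((e x : (⊤ : Subgroup (AddChar K ℂ))) : (⊤ : Subgroup (AddChar K ℂ))) : AddChar K ℂ) (obs q) := fun x q => by
    rw [hW, he]
  obtain ⟨hmain, hcard⟩ := MatchingAdeleG₂.stableOrbitalSum_map_toAdelic_eq_of_equiv ⊤ obs e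
    (MatchingAdeleG₂.forall_mem_top_addChar_obs_eq_one_iff obs hHasse) hinj W hW' m f hfin
  rw [hmain, hcard, Nat.cast_add, Nat.cast_one]

include hK hdeg hsum hs hrange in
/-- **`#{𝒪H ↦ 𝒪(γ₀)} + 1 = 2^{|ι|−1} = |𝓡(G_γ₀∕F)|`**: with the endoscopic classes indexed injectively onto the degree-one Cartan factors, their number plus
one is the order of the character group of the sum-zero hyperplane (`4 ∕ 2 ∕ 1` for `|ι| = 3 ∕ 2 ∕ 1`). [cite: Rogawski1990, §5.4 (5.4.5) p. 74; §3.6 p. 31] -/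
theorem card_add_one_eq_two_pow_of_sum_deg_eq_three : Fintype.card I + 1 = 2 ^ (Fintype.card ι - 1) := by
  classical
  haveI : Fintype (⊤ : Subgroup (AddChar K ℂ)) := Fintype.ofFinite _
  obtain ⟨e, -⟩ := exists_equiv_addChar_ne_one_of_sum_deg_eq_three K hK deg hdeg hsum s hs hrange
  have he1 : ∀ x, ((e x : {χ : (⊤ : Subgroup (AddChar K ℂ)) // χ ≠ 1}) : (⊤ : Subgroup (AddChar K ℂ))) ≠ 1 := fun x => (e x).2
  have heinj : Function.Injective fun x => ((e x : {χ : (⊤ : Subgroup (AddChar K ℂ)) // χ ≠ 1}) : (⊤ : Subgroup (AddChar K ℂ))) :=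
    fun x y h => e.injective (Subtype.ext h)
  have hsurj : ∀ κ : (⊤ : Subgroup (AddChar K ℂ)), κ ≠ 1 → ∃ x, ((e x : {χ : (⊤ : Subgroup (AddChar K ℂ)) // χ ≠ 1}) : (⊤ : Subgroup (AddChar K ℂ))) = κ :=
    fun κ hκ => ⟨e.symm ⟨κ, hκ⟩, by rw [Equiv.apply_symm_apply]⟩
  rw [← card_top_subgroup_addChar_eq_two_pow K hK, card_subgroup_eq_card_add_one ⊤ _ he1 heinj hsurj]

include hK hdeg hsum hs hrange in
/-- The same count normalised by `|𝓡(G_γ₀∕F)| = |𝔇(T∕F)| = 2^{|ι|−1}` (`4 ∕ 2 ∕ 1` for the Cartan types (1) ∕ (2) ∕ (3)):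
`Σ_{[γ] ⊂ 𝒪_st(γ₀)} Φ_m([toAdelic γ], f) = (2^{|ι|−1})⁻¹ · (Φ^{st,𝐀}(γ₀, f) + Σ_{x ∈ I} adelicKappaOrbitalSum 𝒞′_𝐀(γ₀) (W x) m f)`.
[cite: Rogawski1990, §5.4 (5.4.2)–(5.4.5) pp. 72–74; §3.6 p. 31] [cite: Kottwitz1986, §9] -/
theorem MatchingAdeleG₂.stableOrbitalSum_map_toAdelic_eq_of_sum_deg_eq_three_two_pow
    (hHasse : ∀ p : MatchingAdeleG₂ L H H γ₀, obs p = 0 ↔ ∃ γ, p.IsRationalOver γ)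
    (hinj : Set.InjOn (ConjClasses.map (UnitaryGroup.cmDatum L 3 H).toAdelic) (conjClassesIn (cmConjRingHom L) H γ₀))
    (W : I → ConjClasses (UnitaryGroup.cmDatum L 3 H).Adelic → ℂ)
    (hW : ∀ (x : I) (q : MatchingAdeleG₂ L H H γ₀), W x (ConjClasses.mk q.adele) = (-1 : ℂ) ^ (((obs q : K) : ι → ZMod 2) (s x)).val)
    (m : OrbitalMeasureFamily (UnitaryGroup.cmDatum L 3 H).Adelic) (f : (UnitaryGroup.cmDatum L 3 H).Adelic → ℂ)
    (hfin : (MatchingAdeleG₂.classes L H H γ₀ ∩ Function.support fun δ => classOrbitalIntegral m f δ).Finite) :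
    stableOrbitalSum (cmConjRingHom L) H (fun c => classOrbitalIntegral m f (ConjClasses.map (UnitaryGroup.cmDatum L 3 H).toAdelic c)) γ₀ =
      ((2 : ℂ) ^ (Fintype.card ι - 1))⁻¹ * (adelicStableOrbitalSum (MatchingAdeleG₂.classes L H H γ₀) m f +
        ∑ x, adelicKappaOrbitalSum (MatchingAdeleG₂.classes L H H γ₀) (W x) m f) := by
  rw [MatchingAdeleG₂.stableOrbitalSum_map_toAdelic_eq_of_sum_deg_eq_three K hK deg hdeg hsum s hs hrange obs hHasse hinj W hW m f hfin]
  congr 2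
  have h := card_add_one_eq_two_pow_of_sum_deg_eq_three K hK deg hdeg hsum s hs hrange
  exact_mod_cast h

end Signs

end Literature.NumberTheory.Rogawski1990

end
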